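import Summits.FinalStateConjecture.FinalStateConjecture.Theorems.PhotonSphereChannelsCauchyWaveGlobal
import Summits.FinalStateConjecture.FinalStateConjecture.Theorems.PhotonSphereChannelsWindowedShellChannelsNearShoulder

/-!
# Crux `WindowedShellChannels` (W, item stmt-FinalStateConjecture-14085) — the NEAR/FAR SPLIT for
# lags `h ≤ 2ρ`, and "W for thick shells ⟸ its far half"

Support file (registered stubs `stub_nearFarSplit`, `stub_thickShell_of_far`; `--supports`).

**Split** (`stub_nearFarSplit`).  For a global Regge–Wheeler solution `ψ` whose Cauchy data vanish
on the closed shell `{|x − x_c| ≤ ρ}` (`ρ > 0`), cut the data at the photon sphere into a near and a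
far piece; both are again `C² × C¹` (they agree with the data or with `0` on the open cover
`{x < x_c + ρ}`, `{x > x_c − ρ}`), so by the global Cauchy theorem for arbitrary data
(`CauchyWaveGlobal.stub_rwGlobalCauchy`) and uniqueness `ψ = ψ_n + ψ_f` with global solutions of
one-sided data.  By the domain of dependence `ψ_n ≡ 0` on `{x ≥ x_c − ρ + |t|}`, `ψ_f ≡ 0` on
`{x ≤ x_c + ρ − |t|}`; for `h ≤ 2ρ` the lagged window `{|x − x_c| > ρ − h + |t|}` lies in the union
of the two open vanishing regions, so `e[ψ] = e[ψ_n] + e[ψ_f]` pointwise on the window (and at `t = 0`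
everywhere), the windowed energies add, and super-additivity of `liminf` turns the two ONE-SIDED
windowed inequalities (constants `c_n`, `c_f`, aperture `ρ − h`) into the two-ended one for all data
off the shell with constant `min c_n c_f`.  (For `h > 2ρ` the split is not a reduction.)

**Thick shells** (`stub_thickShell_of_far`).  With the landed near half
`WindowedShellChannelsNear.stub_nearShoulder` (`ρ ≥ 9M`, aperture `M/3 + 2M log(3/2)`, constant
`1/2`), W for every `ρ ≥ 9M` follows from ANY far-side one-sided windowed inequality with lag
`h_f ≤ 2ρ` (aperture `min (M/3 + 2M log(3/2)) (ρ − h_f)`, constant `min (1/2) c_f`): the far half —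
the parity-sensitive part of W (evidence `W-seat1-far-obstruction.md`) — is the only missing piece
for thick shells.  No definitions are introduced.
-/

noncomputable section

set_option linter.dupNamespace false

open Set Filter Topology Function MeasureTheory
open scoped ENNReal

namespace Summit.FinalStateConjecture.FinalStateConjecture.Theorems.WindowedShellChannelsSplit

open Literature.Geometry.Lorentzian Literature.Geometry.Lorentzian.ReggeWheeler
open Summit.FinalStateConjecture.FinalStateConjecture.Theorems
open Summit.FinalStateConjecture.FinalStateConjecture.Theorems.CauchyWaveGlobal

/-! ### Tools -/

section Tools

variable {V : ℝ → ℝ}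

/-- Super-additivity of `liminf` in `ℝ≥0∞` along any filter. [folklore] -/
theorem add_liminf_le_liminf_add {ι : Type*} (l : Filter ι) (u v : ι → ℝ≥0∞) :
    liminf u l + liminf v l ≤ liminf (fun i => u i + v i) l := by
  refine le_of_forall_lt_imp_le_of_dense fun d hd => ?_
  by_cases hu : liminf u l = 0
  · rw [hu, zero_add] at hd
    refine le_liminf_of_le (h := ?_)
    filter_upwards [eventually_lt_of_lt_liminf hd] with n hn
    exact hn.le.trans le_add_self
  by_cases hv : liminf v l = 0
  · rw [hv, add_zero] at hd
    refine le_liminf_of_le (h := ?_)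
    filter_upwards [eventually_lt_of_lt_liminf hd] with n hn
    exact hn.le.trans le_self_add
  obtain ⟨a, ha, b, hb, hab⟩ := ENNReal.exists_lt_add_of_lt_add hd hu hv
  refine le_liminf_of_le (h := ?_)
  filter_upwards [eventually_lt_of_lt_liminf ha, eventually_lt_of_lt_liminf hb] with n hna hnb
  exact hab.le.trans (add_le_add hna.le hnb.le)

/-- Channel energies are monotone in the aperture (a smaller aperture sees more energy).
[folklore] -/
theorem channelEnergy_mono_aperture (V : ℝ → ℝ) (xc : ℝ) {ρ ρ' : ℝ} (hρ : ρ' ≤ ρ)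
    (ψ : ℝ → ℝ → ℝ) (l : Filter ℝ) :
    channelEnergy V xc ρ ψ l ≤ channelEnergy V xc ρ' ψ l := by
  refine Filter.liminf_le_liminf (Eventually.of_forall fun t => ?_)
  unfold exteriorEnergy
  refine lintegral_mono_set fun x hx => ?_
  simp only [mem_setOf_eq] at hx ⊢
  linarith

/-- The energy density of a `C²` function along a continuous potential is measurable in `x`.
[folklore] -/
theorem measurable_energyDensity (hV : Continuous V) {ψ : ℝ → ℝ → ℝ}
    (hψ : ContDiff ℝ 2 (uncurry ψ)) (t : ℝ) :
    Measurable fun x => ENNReal.ofReal (energyDensity V ψ t x) := by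
  have hp : Continuous fun x : ℝ => ((t, x) : ℝ × ℝ) := continuous_const.prodMk continuous_id
  have h1 : Continuous fun x => fderiv ℝ (uncurry ψ) (t, x) (1, 0) :=
    (WaveEnergy.continuous_fderiv_apply hψ (1, 0)).comp hp
  have h2 : Continuous fun x => fderiv ℝ (uncurry ψ) (t, x) (0, 1) :=
    (WaveEnergy.continuous_fderiv_apply hψ (0, 1)).comp hp
  have h3 : Continuous fun x => ψ t x := hψ.continuous.comp hp
  have heq : (fun x => energyDensity V ψ t x) = fun x =>
      (fderiv ℝ (uncurry ψ) (t, x) (1, 0)) ^ 2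
        + (fderiv ℝ (uncurry ψ) (t, x) (0, 1)) ^ 2 + V x * ψ t x ^ 2 := by
    funext x
    simp only [energyDensity, WaveEnergy.deriv_slice_fst_eq hψ, WaveEnergy.deriv_slice_snd_eq hψ]
  have hc : Continuous fun x => energyDensity V ψ t x := by
    rw [heq]
    exact ((h1.pow 2).add (h2.pow 2)).add (hV.mul (h3.pow 2))
  exact ENNReal.measurable_ofReal.comp hc.measurable

/-- `C^n` from local representatives on a two-set open cover of the line. [folklore] -/
theorem contDiff_of_eqOn_union {n : WithTop ℕ∞} {f g₁ g₂ : ℝ → ℝ} {U₁ U₂ : Set ℝ}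
    (hU₁ : IsOpen U₁) (hU₂ : IsOpen U₂) (hcov : ∀ x, x ∈ U₁ ∨ x ∈ U₂)
    (hg₁ : ContDiff ℝ n g₁) (hg₂ : ContDiff ℝ n g₂) (h₁ : EqOn f g₁ U₁) (h₂ : EqOn f g₂ U₂) :
    ContDiff ℝ n f := by
  rw [contDiff_iff_contDiffAt]
  intro x
  rcases hcov x with hx | hx
  · exact hg₁.contDiffAt.congr_of_eventuallyEq (eventuallyEq_of_mem (hU₁.mem_nhds hx) h₁)
  · exact hg₂.contDiffAt.congr_of_eventuallyEq (eventuallyEq_of_mem (hU₂.mem_nhds hx) h₂)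

/-- A function of `(t, x)` vanishing near `(t, x)` vanishes there to first order in the slice
sense. [folklore] -/
theorem firstOrder_vanish_of_eventually {φ : ℝ → ℝ → ℝ} {t x : ℝ}
    (h : ∀ᶠ z in 𝓝 (t, x), uncurry φ z = 0) :
    φ t x = 0 ∧ deriv (fun τ => φ τ x) t = 0 ∧ deriv (φ t) x = 0 := by
  have ht : (fun τ => φ τ x) =ᶠ[𝓝 t] fun _ => (0 : ℝ) :=
    ((continuous_id.prodMk continuous_const).tendsto t).eventually h
  have hx : (fun y => φ t y) =ᶠ[𝓝 x] fun _ => (0 : ℝ) :=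
    ((continuous_const.prodMk continuous_id).tendsto x).eventually h
  refine ⟨h.self_of_nhds, ?_, ?_⟩
  · rw [ht.deriv_eq, deriv_const]
  · rw [show φ t = fun y => φ t y from rfl, hx.deriv_eq, deriv_const]

/-- The energy density vanishes where the function vanishes to first order. [folklore] -/
theorem energyDensity_eq_zero_of_vanish {φ : ℝ → ℝ → ℝ} {t x : ℝ}
    (hv : φ t x = 0) (ht : deriv (fun τ => φ τ x) t = 0) (hx : deriv (φ t) x = 0) :
    energyDensity V φ t x = 0 := by
  unfold energyDensity
  rw [hv, ht, hx]
  ring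

/-- Energy density of a sum whose FIRST summand vanishes to first order at the point. [folklore] -/
theorem energyDensity_add_of_left_vanish {ψ₁ ψ₂ : ℝ → ℝ → ℝ} (h₁ : ContDiff ℝ 2 (uncurry ψ₁))
    (h₂ : ContDiff ℝ 2 (uncurry ψ₂)) {t x : ℝ} (hv : ψ₁ t x = 0)
    (ht : deriv (fun τ => ψ₁ τ x) t = 0) (hx : deriv (ψ₁ t) x = 0) :
    energyDensity V (fun t x => 1 * ψ₁ t x + 1 * ψ₂ t x) t x = energyDensity V ψ₂ t x := by
  unfold energyDensity
  beta_reduce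
  rw [deriv_lincomb_fst h₁ h₂, deriv_lincomb_snd h₁ h₂, hv, ht, hx]
  ring

/-- Energy density of a sum whose SECOND summand vanishes to first order at the point.
[folklore] -/
theorem energyDensity_add_of_right_vanish {ψ₁ ψ₂ : ℝ → ℝ → ℝ} (h₁ : ContDiff ℝ 2 (uncurry ψ₁))
    (h₂ : ContDiff ℝ 2 (uncurry ψ₂)) {t x : ℝ} (hv : ψ₂ t x = 0)
    (ht : deriv (fun τ => ψ₂ τ x) t = 0) (hx : deriv (ψ₂ t) x = 0) :
    energyDensity V (fun t x => 1 * ψ₁ t x + 1 * ψ₂ t x) t x = energyDensity V ψ₁ t x := by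
  unfold energyDensity
  beta_reduce
  rw [deriv_lincomb_fst h₁ h₂, deriv_lincomb_snd h₁ h₂, hv, ht, hx]
  ring

/-- Cutting a `C^n` function that vanishes on `[x_c − ρ, x_c + ρ]` (`ρ > 0`) at `x_c` gives two
`C^n` functions. [folklore] -/
theorem contDiff_cut {n : WithTop ℕ∞} {f : ℝ → ℝ} {xc ρ : ℝ} (hρ : 0 < ρ) (hf : ContDiff ℝ n f)
    (h0 : ∀ y, |y - xc| ≤ ρ → f y = 0) :
    ContDiff ℝ n (fun x => if x < xc then f x else 0)
      ∧ ContDiff ℝ n (fun x => if x < xc then 0 else f x) := by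
  have hcov : ∀ y : ℝ, y ∈ Iio (xc + ρ) ∨ y ∈ Ioi (xc - ρ) := by
    intro y
    by_cases hy : y < xc + ρ
    · exact Or.inl hy
    · right; simp only [mem_Ioi]; linarith
  have key : ∀ y, (y < xc + ρ ∧ ¬ y < xc) ∨ (xc - ρ < y ∧ y < xc) → f y = 0 := by
    intro y hy
    apply h0
    rw [abs_le]
    rcases hy with ⟨h1, h2⟩ | ⟨h1, h2⟩ <;> constructor <;> linarith
  refine ⟨contDiff_of_eqOn_union isOpen_Iio isOpen_Ioi hcov hf (contDiff_const (c := (0 : ℝ)))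
      (fun y hy => ?_) (fun y hy => ?_),
    contDiff_of_eqOn_union isOpen_Iio isOpen_Ioi hcov (contDiff_const (c := (0 : ℝ))) hf
      (fun y hy => ?_) (fun y hy => ?_)⟩
  · show (if y < xc then f y else 0) = f y
    split_ifs with h1
    · rfl
    · exact (key y (Or.inl ⟨hy, h1⟩)).symm
  · show (if y < xc then f y else 0) = 0
    split_ifs with h1
    · exact key y (Or.inr ⟨hy, h1⟩)
    · rfl
  · show (if y < xc then 0 else f y) = 0
    split_ifs with h1
    · rfl
    · exact key y (Or.inl ⟨hy, h1⟩)
  · show (if y < xc then 0 else f y) = f y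
    split_ifs with h1
    · exact (key y (Or.inr ⟨hy, h1⟩)).symm
    · rfl

/-- The time-derivative datum `x ↦ ψ_t(0, x)` of a `C²` function is `C¹`. [folklore] -/
theorem contDiff_one_velocityDatum {ψ : ℝ → ℝ → ℝ} (hψ : ContDiff ℝ 2 (uncurry ψ)) :
    ContDiff ℝ 1 fun x => deriv (fun τ => ψ τ x) 0 := by
  have heq : (fun x => deriv (fun τ => ψ τ x) 0) = fun x => fderiv ℝ (uncurry ψ) (0, x) (1, 0) :=
    funext fun x => WaveEnergy.deriv_slice_fst_eq hψ 0 x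
  rw [heq]
  exact ((hψ.fderiv_right (m := 1) (by norm_num)).comp
    (contDiff_const.prodMk contDiff_id)).clm_apply contDiff_const

end Tools

/-! ### The near/far split -/

/-- **Registered stub `stub_nearFarSplit`** (crux `WindowedShellChannels`,
item stmt-FinalStateConjecture-14085): for lags `h ≤ 2ρ` the two-ended windowed channel inequality
for all data supported off the shell `{|x − x_c| ≤ ρ}` follows from the two ONE-SIDED ones (near
data in `(−∞, x_c − ρ)` with constant `c_n`, far data in `(x_c + ρ, ∞)` with constant `c_f`, same
aperture `ρ − h`), with constant `min c_n c_f`. -/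
theorem stub_nearFarSplit : ∀ (M ρ h cn cf : ℝ), 0 < ρ → h ≤ 2 * ρ → ∀ (r : ℝ → ℝ) (xc : ℝ), IsTortoiseRadius M r xc → ∀ (s ℓ : ℕ), s ≤ ℓ → (∀ ψ : ℝ → ℝ → ℝ, IsRWSolution M s ℓ r ψ → CauchyDataSupportedOn ψ (Set.Iio (xc - ρ)) → ENNReal.ofReal cn * totalEnergy (linePotential M s ℓ r) ψ 0 ≤ channelEnergy (linePotential M s ℓ r) xc (ρ - h) ψ atTop + channelEnergy (linePotential M s ℓ r) xc (ρ - h) ψ atBot) → (∀ ψ : ℝ → ℝ → ℝ, IsRWSolution M s ℓ r ψ → CauchyDataSupportedOn ψ (Set.Ioi (xc + ρ)) → ENNReal.ofReal cf * totalEnergy (linePotential M s ℓ r) ψ 0 ≤ channelEnergy (linePotential M s ℓ r) xc (ρ - h) ψ atTop + channelEnergy (linePotential M s ℓ r) xc (ρ - h) ψ atBot) → ∀ ψ : ℝ → ℝ → ℝ, IsRWSolution M s ℓ r ψ → CauchyDataSupportedOn ψ {x : ℝ | ρ < |x - xc|} → ENNReal.ofReal (min cn cf) * totalEnergy (linePotential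 M s ℓ r) ψ 0 ≤ channelEnergy (linePotential M s ℓ r) xc (ρ - h) ψ atTop + channelEnergy (linePotential M s ℓ r) xc (ρ - h) ψ atBot := by
  intro M ρ h cn cf hρ hh r xc hr s ℓ hsℓ HN HF ψ hψ hsupp
  set V : ℝ → ℝ := linePotential M s ℓ r with hVdef
  have hVd : Differentiable ℝ V := RW.differentiable_linePotential hr s ℓ
  have hV0 : ∀ x, 0 ≤ V x := fun x => (RW.linePotential_pos hr hsℓ x).le
  have hVc : Continuous V := hVd.continuous
  have hC : ContDiff ℝ 2 (uncurry ψ) := hψ.1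
  -- the data and their vanishing on the closed shell
  have hA : ContDiff ℝ 2 (fun x => ψ 0 x) := contDiff_slice_snd hC 0
  have hB : ContDiff ℝ 1 (fun x => deriv (fun τ => ψ τ x) 0) := contDiff_one_velocityDatum hC
  have hdata0 : ∀ y, |y - xc| ≤ ρ → ψ 0 y = 0 ∧ deriv (fun τ => ψ τ y) 0 = 0 := by
    intro y hy
    exact hsupp y (by simp only [mem_setOf_eq, not_lt]; exact hy)
  -- near and far pieces of the data: `C²`/`C¹`
  obtain ⟨hAn, hAf⟩ := contDiff_cut (xc := xc) hρ hA fun y hy => (hdata0 y hy).1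
  obtain ⟨hBn, hBf⟩ := contDiff_cut (xc := xc) hρ hB fun y hy => (hdata0 y hy).2
  -- the near and far solutions
  obtain ⟨ψn, hψn, hDn0, hDn1⟩ := stub_rwGlobalCauchy M r xc hr s ℓ hsℓ _ _ hAn hBn
  obtain ⟨ψf, hψf, hDf0, hDf1⟩ := stub_rwGlobalCauchy M r xc hr s ℓ hsℓ _ _ hAf hBf
  have hCn : ContDiff ℝ 2 (uncurry ψn) := hψn.1
  have hCf : ContDiff ℝ 2 (uncurry ψf) := hψf.1
  -- one-sided vanishing of the pieces' data
  have hn_data : ∀ y, xc - ρ ≤ y → ψn 0 y = 0 ∧ deriv (fun τ => ψn τ y) 0 = 0 := by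
    intro y hy
    rw [hDn0, hDn1]
    by_cases h1 : y < xc
    · rw [if_pos h1, if_pos h1]
      exact hdata0 y (by rw [abs_le]; constructor <;> linarith)
    · rw [if_neg h1, if_neg h1]; exact ⟨rfl, rfl⟩
  have hf_data : ∀ y, y ≤ xc + ρ → ψf 0 y = 0 ∧ deriv (fun τ => ψf τ y) 0 = 0 := by
    intro y hy
    rw [hDf0, hDf1]
    by_cases h1 : y < xc
    · rw [if_pos h1, if_pos h1]; exact ⟨rfl, rfl⟩
    · rw [if_neg h1, if_neg h1]
      exact hdata0 y (by rw [abs_le]; constructor <;> linarith)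
  have hn_supp : CauchyDataSupportedOn ψn (Iio (xc - ρ)) := fun y hy =>
    hn_data y (by simpa only [mem_Iio, not_lt] using hy)
  have hf_supp : CauchyDataSupportedOn ψf (Ioi (xc + ρ)) := fun y hy =>
    hf_data y (by simpa only [mem_Ioi, not_lt] using hy)
  -- the sum has the data of ψ, hence equals ψ
  set φ : ℝ → ℝ → ℝ := fun t x => 1 * ψn t x + 1 * ψf t x with hφdef
  have hφ : IsRWSolution M s ℓ r φ := isSolution_lincomb hψn hψf 1 1
  have hEq : ψ = φ := by
    refine solution_unique hVd hV0 hψ hφ (fun y => ?_) (fun y => ?_)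
    · show ψ 0 y = 1 * ψn 0 y + 1 * ψf 0 y
      rw [hDn0, hDf0]
      split_ifs <;> ring
    · show deriv (fun τ => ψ τ y) 0 = deriv (fun τ => 1 * ψn τ y + 1 * ψf τ y) 0
      rw [deriv_lincomb_fst hCn hCf, hDn1, hDf1]
      split_ifs <;> ring
  -- domains of dependence of the pieces
  have hn_zero : ∀ t y, xc - ρ + |t| ≤ y → ψn t y = 0 := fun t y hy =>
    curried_eq_zero_of_data hVd hV0 hψn (a := xc - ρ) (b := y + |t|)
      (fun z hz => (hn_data z hz.1).1) (fun z hz => (hn_data z hz.1).2) hy (by linarith)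
  have hf_zero : ∀ t y, y ≤ xc + ρ - |t| → ψf t y = 0 := fun t y hy =>
    curried_eq_zero_of_data hVd hV0 hψf (a := y - |t|) (b := xc + ρ)
      (fun z hz => (hf_data z hz.2).1) (fun z hz => (hf_data z hz.2).2) (by linarith) hy
  have hn_ev : ∀ t y, xc - ρ + |t| < y → ∀ᶠ z in 𝓝 (t, y), uncurry ψn z = 0 := by
    intro t y hy
    have ho : IsOpen {z : ℝ × ℝ | xc - ρ + |z.1| < z.2} := isOpen_lt (by fun_prop) (by fun_prop)
    filter_upwards [ho.mem_nhds (show (t, y) ∈ {z : ℝ × ℝ | xc - ρ + |z.1| < z.2} from hy)]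
      with z hz
    exact hn_zero z.1 z.2 (le_of_lt hz)
  have hf_ev : ∀ t y, y < xc + ρ - |t| → ∀ᶠ z in 𝓝 (t, y), uncurry ψf z = 0 := by
    intro t y hy
    have ho : IsOpen {z : ℝ × ℝ | z.2 < xc + ρ - |z.1|} := isOpen_lt (by fun_prop) (by fun_prop)
    filter_upwards [ho.mem_nhds (show (t, y) ∈ {z : ℝ × ℝ | z.2 < xc + ρ - |z.1|} from hy)]
      with z hz
    exact hf_zero z.1 z.2 (le_of_lt hz)
  -- pointwise splitting of the energy density: at t = 0 everywhere, and on the window at every t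
  have hsplit : ∀ t y, (xc - ρ + |t| < y ∨ y < xc + ρ - |t|) →
      energyDensity V ψ t y = energyDensity V ψn t y + energyDensity V ψf t y := by
    intro t y hy
    rw [hEq]
    rcases hy with hy | hy
    · obtain ⟨h0, h1, h2⟩ := firstOrder_vanish_of_eventually (hn_ev t y hy)
      rw [energyDensity_add_of_left_vanish hCn hCf h0 h1 h2, energyDensity_eq_zero_of_vanish h0 h1 h2,
        zero_add]
    · obtain ⟨h0, h1, h2⟩ := firstOrder_vanish_of_eventually (hf_ev t y hy)
      rw [energyDensity_add_of_right_vanish hCn hCf h0 h1 h2,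
        energyDensity_eq_zero_of_vanish h0 h1 h2, add_zero]
  have hsplit0 : ∀ y, energyDensity V ψ 0 y = energyDensity V ψn 0 y + energyDensity V ψf 0 y := by
    intro y
    refine hsplit 0 y ?_
    rw [abs_zero, add_zero, sub_zero]
    by_cases hy' : xc - ρ < y
    · exact Or.inl hy'
    · right; linarith
  -- total energy at t = 0 splits
  have hE0 : totalEnergy V ψ 0 = totalEnergy V ψn 0 + totalEnergy V ψf 0 := by
    unfold totalEnergy
    rw [← lintegral_add_left (measurable_energyDensity hVc hCn 0)]
    refine lintegral_congr fun y => ?_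
    rw [hsplit0 y, ENNReal.ofReal_add (energyDensity_nonneg _ _ (hV0 y)) (energyDensity_nonneg _ _ (hV0 y))]
  -- windowed exterior energies split at every time
  have hEt : ∀ t, exteriorEnergy V xc (ρ - h) ψ t
      = exteriorEnergy V xc (ρ - h) ψn t + exteriorEnergy V xc (ρ - h) ψf t := by
    intro t
    unfold exteriorEnergy
    have hmeas : MeasurableSet {x : ℝ | ρ - h + |t| < |x - xc|} :=
      (isOpen_lt continuous_const (by fun_prop)).measurableSet
    rw [← lintegral_add_left (measurable_energyDensity hVc hCn t)]
    refine setLIntegral_congr_fun hmeas fun y hy => ?_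
    simp only [mem_setOf_eq] at hy
    have hy' : xc - ρ + |t| < y ∨ y < xc + ρ - |t| := by
      rcases le_or_gt 0 (y - xc) with hs | hs
      · rw [abs_of_nonneg hs] at hy; left; linarith
      · rw [abs_of_neg hs] at hy; right; linarith
    rw [hsplit t y hy', ENNReal.ofReal_add (energyDensity_nonneg _ _ (hV0 y)) (energyDensity_nonneg _ _ (hV0 y))]
  -- channel energies are super-additive under the split
  have hch : ∀ l : Filter ℝ, channelEnergy V xc (ρ - h) ψn l + channelEnergy V xc (ρ - h) ψf l
      ≤ channelEnergy V xc (ρ - h) ψ l := by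
    intro l
    unfold channelEnergy
    rw [show exteriorEnergy V xc (ρ - h) ψ = fun t => exteriorEnergy V xc (ρ - h) ψn t
        + exteriorEnergy V xc (ρ - h) ψf t from funext hEt]
    exact add_liminf_le_liminf_add l _ _
  -- assemble
  have Kn := HN ψn hψn hn_supp
  have Kf := HF ψf hψf hf_supp
  have hc1 : ENNReal.ofReal (min cn cf) ≤ ENNReal.ofReal cn := ENNReal.ofReal_le_ofReal (min_le_left _ _)
  have hc2 : ENNReal.ofReal (min cn cf) ≤ ENNReal.ofReal cf := ENNReal.ofReal_le_ofReal (min_le_right _ _)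
  calc ENNReal.ofReal (min cn cf) * totalEnergy V ψ 0
      = ENNReal.ofReal (min cn cf) * totalEnergy V ψn 0
          + ENNReal.ofReal (min cn cf) * totalEnergy V ψf 0 := by rw [hE0, mul_add]
    _ ≤ ENNReal.ofReal cn * totalEnergy V ψn 0 + ENNReal.ofReal cf * totalEnergy V ψf 0 :=
        add_le_add (mul_le_mul_left hc1 _) (mul_le_mul_left hc2 _)
    _ ≤ (channelEnergy V xc (ρ - h) ψn atTop + channelEnergy V xc (ρ - h) ψn atBot)
          + (channelEnergy V xc (ρ - h) ψf atTop + channelEnergy V xc (ρ - h) ψf atBot) :=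
        add_le_add Kn Kf
    _ = (channelEnergy V xc (ρ - h) ψn atTop + channelEnergy V xc (ρ - h) ψf atTop)
          + (channelEnergy V xc (ρ - h) ψn atBot + channelEnergy V xc (ρ - h) ψf atBot) := by
        rw [add_add_add_comm]
    _ ≤ channelEnergy V xc (ρ - h) ψ atTop + channelEnergy V xc (ρ - h) ψ atBot :=
        add_le_add (hch atTop) (hch atBot)

/-! ### W for thick shells from its far half -/

/-- **Registered stub `stub_thickShell_of_far`** (crux `WindowedShellChannels`,
item stmt-FinalStateConjecture-14085): for shells of half-width `ρ ≥ 9M`, the two-ended windowed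
channel inequality for ALL data supported off the shell follows from any one-sided FAR-data
inequality with lag `h_f ≤ 2ρ` (aperture `ρ − h_f`) and constant `c_f`, via the landed near half
`stub_nearShoulder` and the split; aperture `min (M/3 + 2M log(3/2)) (ρ − h_f)`, constant
`min (1/2) c_f`. -/
theorem stub_thickShell_of_far : ∀ M : ℝ, 0 < M → ∀ (ρ hf cf : ℝ), 9 * M ≤ ρ → hf ≤ 2 * ρ → (∀ (r : ℝ → ℝ) (xc : ℝ), IsTortoiseRadius M r xc → ∀ (s ℓ : ℕ), s ≤ 2 → s ≤ ℓ → ∀ ψ : ℝ → ℝ → ℝ, IsRWSolution M s ℓ r ψ → CauchyDataSupportedOn ψ (Set.Ioi (xc + ρ)) → ENNReal.ofReal cf * totalEnergy (linePotential M s ℓ r) ψ 0 ≤ channelEnergy (linePotential M s ℓ r) xc (ρ - hf) ψ atTop + channelEnergy (linePotential M s ℓ r) xc (ρ - hf) ψ atBot) → ∀ (r : ℝ → ℝ) (xc : ℝ), IsTortoiseRadius M r xc → ∀ (s ℓ : ℕ), s ≤ 2 → s ≤ ℓ → ∀ ψ : ℝ → ℝ → ℝ, IsRWSolution M s ℓ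 r ψ → CauchyDataSupportedOn ψ {x : ℝ | ρ < |x - xc|} → ENNReal.ofReal (min (1 / 2) cf) * totalEnergy (linePotential M s ℓ r) ψ 0 ≤ channelEnergy (linePotential M s ℓ r) xc (min (M / 3 + 2 * M * Real.log (3 / 2)) (ρ - hf)) ψ atTop + channelEnergy (linePotential M s ℓ r) xc (min (M / 3 + 2 * M * Real.log (3 / 2)) (ρ - hf)) ψ atBot := by
  intro M hM ρ hf cf hρ hhf HF r xc hr s ℓ hs hsℓ ψ hψ hsupp
  set a₀ : ℝ := M / 3 + 2 * M * Real.log (3 / 2) with ha₀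
  set a : ℝ := min a₀ (ρ - hf) with ha
  have hρ0 : 0 < ρ := by linarith
  -- the lag of the combined window and `h ≤ 2ρ`
  have hlog : 0 ≤ Real.log (3 / 2) := Real.log_nonneg (by norm_num)
  have ha₀pos : 0 < a₀ := by rw [ha₀]; positivity
  have hh : ρ - a ≤ 2 * ρ := by
    have : ρ - hf ≥ -ρ := by linarith
    have : a ≥ min a₀ (-ρ) := min_le_min_left a₀ this
    have : min a₀ (-ρ) = -ρ := min_eq_right (by linarith)
    linarith
  have key := stub_nearFarSplit M ρ (ρ - a) (1 / 2) cf hρ0 hh r xc hr s ℓ hsℓ ?_ ?_ ψ hψ hsupp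
  · simpa only [sub_sub_cancel] using key
  · -- near half at aperture `a ≤ a₀` from the shoulder theorem
    intro φ hφ hφsupp
    have K := WindowedShellChannelsNear.stub_nearShoulder M hM ρ hρ r xc hr s ℓ hs hsℓ φ hφ hφsupp
    rw [sub_sub_cancel]
    exact K.trans (add_le_add (channelEnergy_mono_aperture _ xc (min_le_left _ _) φ atTop)
      (channelEnergy_mono_aperture _ xc (min_le_left _ _) φ atBot))
  · -- far half at aperture `a ≤ ρ − h_f` from the hypothesis
    intro φ hφ hφsupp
    have K := HF r xc hr s ℓ hs hsℓ φ hφ hφsupp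
    rw [sub_sub_cancel]
    exact K.trans (add_le_add (channelEnergy_mono_aperture _ xc (min_le_right _ _) φ atTop)
      (channelEnergy_mono_aperture _ xc (min_le_right _ _) φ atBot))

end Summit.FinalStateConjecture.FinalStateConjecture.Theorems.WindowedShellChannelsSplit

end
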